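import Summits.QuantumAdvantage.QuantumAdvantage.Theorems.LinnikCubicClassGroupsDegreeOnePrimesEscapeLowerPITSmoothedAux
import Literature.NumberTheory.LFunctions.RayClassFamily
import Literature.NumberTheory.LFunctions.RayClassExplicitFormulaBounds
import HarnessLib

/-!
# Linnik's theorem for cosets of a congruence class group, I: inputs — zeros of the family, the zero-free
# regions in `Q`-form (classical and Deuring–Heilbronn), the trivial-zero and left-line terms

Topic `Summits/QuantumAdvantage/QuantumAdvantage/Theorems`, cell B2b-1 (linnik-cubic), PART A (gen 22); helper
toward the crux `DegreeOnePrimesEscape` (stmt-QuantumAdvantage-11543) of route `LinnikCubicClassGroups` — the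
ray-class (congruence class group `mod 𝔪`) counterpart of `…ClassPNTDHInputs` / `…ClassPNTSmoothedMain` /
`…PerCharacterDeficitSmoothedBound`.  HONEST FRAMING: the value of this file is a THEOREM (kernel-checked, GRH-free
lemmas) — NOT summit progress (the route still rests on the hypothesis-type target `PureCubicClassNumberHard`).

Setting: a number field `K`, an abelian Frobenius datum `f : 𝔭 ↦ f 𝔭 ∈ G` killing the narrow ray `mod 𝔪 ≠ 0`
whose non-trivial characters are non-principal off `𝔪` (a congruence class group), the family
`F_ψ = rayFamF … ψ` (`F_0 = ζ₁_K`, `F_ψ = L_ψ` the entire Hecke `L`-function of the primitive associate of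
`ψ ∘ f`), and a SIZE PARAMETER `Q ≥ Q_𝔪 = |d_K| n^n N𝔪` (`rayCondQ`), `Q ≥ 12` — downstream files take `Q`
generic so that the purely real-variable numerics of `…ClassPNTDHNumerics` apply verbatim and the final file can
choose `Q` a fixed power of `Q_𝔪`.

* `rayFamZ_of_eq_zero` / `eq_zero_of_rayFamZ` — `F_ψ(ρ) = 0` versus the zero predicate
  `(ψ = 0 → ζ₁_K ρ = 0) ∧ (∀ hψ, L_ψ ρ = 0)` of `deuringHeilbronn_congruence`;
* `rayZfr_classical` — off the exceptional segment `rayExcRegion c K 𝔪` every zero with `1/4 ≤ β < 1` has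
  `β ≤ 1 − c/(a log Q + log(|γ|+4))` (clause (1) of `exists_exceptionalZero_congruence_const`, `c ≤ c₀`, `a ≥ 1`);
* `ray_zfr_of_zeroRepulsion` — **Deuring–Heilbronn ⇒ zero-free region in `Q`-form**: if `β₁ ∈ rayExcRegion c K 𝔪`,
  `2Cn(1−β₁) log x ≤ 1/3`, `Q ≤ x`, `log x ≥ 4`, and the repulsion `log(1/(Cℒ(1−β₁)))/(Cℒ) ≤ 1 − Re ρ`
  (`ℒ = log(|d_K|N𝔪) + n(log(|γ|+2)+1)`) holds for the zeros `ρ ≠ 1, β₁` with `Re ρ ≥ 1/2`, then off the segment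
  `β ≤ 1 − c_Z/(a log Q + log(|γ|+4))`, `c_Z = min(log(1/(2Cn(1−β₁)log x))/(Cn), a log Q/2)`;
* `rayFamMult_zero_term_le`, `rayLeftLine_term_le` — `m_ψ(0)(L+ε) ≤ 1152 e^{L/4}` and
  `‖J_ψ(0)‖ ≤ 8·leftLineConst·C(n+1)M` for `g = tzTest L ε`, `Q ≤ e^{L/8}` (`ψ ≠ 0`; the `ψ = 0` twins are the
  tree's `trivialZero_term_le_one`, `leftLine_term_le_one`).

References: J. Thorner, A. Zaman, Algebra Number Theory 11 (2017), Thm 3.1, §7 [ThornerZaman2017]; A. Weiss,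
J. reine angew. Math. 338 (1983), §§5–6 [Weiss1983]; J. C. Lagarias, H. L. Montgomery, A. M. Odlyzko, Invent. Math.
54 (1979), Thm 5.1 [LagariasMontgomeryOdlyzko1979].
-/

noncomputable section

open Complex Real MeasureTheory Set Filter Topology NumberField IsDedekindDomain
open scoped NumberField nonZeroDivisors

namespace Summit.QuantumAdvantage.QuantumAdvantage.Theorems.DegreeOnePrimesEscape

open Literature.NumberTheory.LFunctions Literature.NumberTheory.LFunctions.NumberField
  Literature.NumberTheory.LFunctions.EntireEF Literature.NumberTheory.LFunctions.TZWeight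
  Literature.NumberTheory.LFunctions.AbelianDensity
open scoped Classical

variable {K : Type} [Field K] [NumberField K]
variable {G : Type} [CommGroup G] [Finite G] {𝔪 : Ideal (𝓞 K)} {f : HeightOneSpectrum (𝓞 K) → G}
variable (h𝔪 : 𝔪 ≠ ⊥) (hray : ArtinKillsRay 𝔪 f)
  (hsep : ∀ χ : AddChar (Additive G) ℂ, χ ≠ 0 →
    ∃ v : HeightOneSpectrum (𝓞 K), ¬ 𝔪 ≤ v.asIdeal ∧ χ (Additive.ofMul (f v)) ≠ 1)

/-! ### Zeros of the family versus the zero predicate of the Deuring–Heilbronn theorem -/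

/-- A zero of `F_ψ` is a zero of `ζ₁_K` (`ψ = 0`) resp. of `L_ψ` (`ψ ≠ 0`), in the shape consumed by
`deuringHeilbronn_congruence`. -/
theorem rayFamZ_of_eq_zero (ψ : AddChar (Additive G) ℂ) {ρ : ℂ} (h0 : rayFamF h𝔪 hray hsep ψ ρ = 0) :
    (ψ = 0 → dedekindZeta₁ K ρ = 0) ∧ (∀ hψ : ψ ≠ 0, (datumData h𝔪 hray hsep ψ hψ).L ρ = 0) := by
  refine ⟨fun h1 ↦ ?_, fun h1 ↦ ?_⟩
  · subst h1; rwa [rayFamF_zero] at h0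
  · rwa [rayFamF_of_ne h𝔪 hray hsep h1] at h0

/-- Conversely, the zero predicate gives a zero of `F_ψ`. -/
theorem eq_zero_of_rayFamZ (ψ : AddChar (Additive G) ℂ) {ρ : ℂ}
    (h : (ψ = 0 → dedekindZeta₁ K ρ = 0) ∧ (∀ hψ : ψ ≠ 0, (datumData h𝔪 hray hsep ψ hψ).L ρ = 0)) :
    rayFamF h𝔪 hray hsep ψ ρ = 0 := by
  by_cases hψ : ψ = 0
  · subst hψ; rw [rayFamF_zero]; exact h.1 rfl
  · rw [rayFamF_of_ne h𝔪 hray hsep hψ]; exact h.2 hψ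

/-- A zero of `F_ψ` in the shape consumed by the Landau–Page package (`datumL`). -/
theorem rayFamZ'_of_eq_zero (ψ : AddChar (Additive G) ℂ) {ρ : ℂ} (h0 : rayFamF h𝔪 hray hsep ψ ρ = 0) :
    (ψ = 0 → dedekindZeta₁ K ρ = 0) ∧ (ψ ≠ 0 → datumL h𝔪 hray hsep ψ ρ = 0) := by
  refine ⟨fun h1 ↦ ?_, fun h1 ↦ ?_⟩
  · subst h1; rwa [rayFamF_zero] at h0
  · rwa [rayFamF_eq_datumL h𝔪 hray hsep h1] at h0

/-! ### Sizes of the size parameter -/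

omit [Finite G] in
include h𝔪 in
/-- For `Q ≥ Q_𝔪 = |d_K| n^n N𝔪` (`𝔪 ≠ 0`, `n_K > 1`): `Q ≥ 12`, `|d_K| N𝔪 ≤ Q`, `0 ≤ log(|d_K|N𝔪) ≤ log Q ≤ Q − 1`,
`n_K ≤ Q`, `condQn K ≤ Q`. -/
theorem raySize_facts (hK : 1 < Module.finrank ℚ K) {Q : ℝ} (hQK : rayCondQ K 𝔪 ≤ Q) :
    12 ≤ Q ∧ ((discr K).natAbs : ℝ) * ((Ideal.absNorm 𝔪 : ℕ) : ℝ) ≤ Q ∧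
      0 ≤ Real.log (((discr K).natAbs : ℝ) * ((Ideal.absNorm 𝔪 : ℕ) : ℝ)) ∧
      Real.log (((discr K).natAbs : ℝ) * ((Ideal.absNorm 𝔪 : ℕ) : ℝ)) ≤ Real.log Q ∧
      Real.log Q ≤ Q - 1 ∧ (Module.finrank ℚ K : ℝ) ≤ Q ∧ ThornerZaman.condQn K ≤ Q := by
  have hQ12 : (12 : ℝ) ≤ Q := (twelve_le_rayCondQ hK h𝔪).trans hQK
  have hd1 := one_le_discr_mul_absNorm K h𝔪
  have hdQ : ((discr K).natAbs : ℝ) * ((Ideal.absNorm 𝔪 : ℕ) : ℝ) ≤ Q := (discr_mul_absNorm_le_rayCondQ 𝔪).trans hQK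
  refine ⟨hQ12, hdQ, Real.log_nonneg hd1, Real.log_le_log (by linarith) hdQ, ?_, ?_, ?_⟩
  · have := Real.log_le_sub_one_of_pos (by linarith : (0 : ℝ) < Q); linarith
  · exact (ThornerZaman.finrank_le_condQn (K := K)).trans ((condQn_le_rayCondQ h𝔪).trans hQK)
  · exact (condQn_le_rayCondQ h𝔪).trans hQK

/-! ### The classical zero-free region off the exceptional segment, `Q`-form -/

omit [Finite G] in
include h𝔪 in
/-- Monotonicity of the Landau–Page region `mod 𝔪` in the constant. -/
theorem rayLpRegion_mono {c c₀ : ℝ} (hcc₀ : c ≤ c₀) {ρ : ℂ}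
    (h : 1 - c / (Real.log (((discr K).natAbs : ℝ) * ((Ideal.absNorm 𝔪 : ℕ) : ℝ)) + Real.log (|ρ.im| + 4)) < ρ.re) :
    1 - c₀ / (Real.log (((discr K).natAbs : ℝ) * ((Ideal.absNorm 𝔪 : ℕ) : ℝ)) + Real.log (|ρ.im| + 4)) < ρ.re := by
  have hlog4 : 0 < Real.log (|ρ.im| + 4) := Real.log_pos (by linarith [abs_nonneg ρ.im])
  have hlogd : 0 ≤ Real.log (((discr K).natAbs : ℝ) * ((Ideal.absNorm 𝔪 : ℕ) : ℝ)) :=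
    Real.log_nonneg (one_le_discr_mul_absNorm K h𝔪)
  have := div_le_div_of_nonneg_right hcc₀ (by linarith : 0 ≤ Real.log (((discr K).natAbs : ℝ) *
    ((Ideal.absNorm 𝔪 : ℕ) : ℝ)) + Real.log (|ρ.im| + 4))
  linarith

/-- **The classical zero-free region in `Q`-form**: if clause (1) of the Landau–Page package holds with a constant
`c₀ ≥ c > 0` (zeros of the family in `Re ρ > 1 − c₀/(log(|d_K|N𝔪) + log(|γ|+4))` are real with `ψ` real), then every
zero of `F_ψ` off `rayExcRegion c K 𝔪` satisfies `Re ρ ≤ 1 − c/(a log Q + log(|γ| + 4))` (`a ≥ 1`, `Q ≥ Q_𝔪`).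
[cite: ThornerZaman2019, Theorem 3.1] -/
theorem rayZfr_classical (hK : 1 < Module.finrank ℚ K) {c c₀ a Q : ℝ} (hc : 0 < c) (hcc₀ : c ≤ c₀) (ha : 1 ≤ a)
    (hQK : rayCondQ K 𝔪 ≤ Q)
    (hpack : ∀ (ψ : AddChar (Additive G) ℂ) (ρ : ℂ),
      (((ψ = 0 → dedekindZeta₁ K ρ = 0) ∧ (ψ ≠ 0 → datumL h𝔪 hray hsep ψ ρ = 0)) ∧
        1 - c₀ / (Real.log (((discr K).natAbs : ℝ) * ((Ideal.absNorm 𝔪 : ℕ) : ℝ)) + Real.log (|ρ.im| + 4)) < ρ.re) →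
      ρ.im = 0 ∧ ψ + ψ = 0)
    (x : ℝ) (ψ : AddChar (Additive G) ℂ) (ρ : ℂ) (h0 : rayFamF h𝔪 hray hsep ψ ρ = 0) (_h14 : 1 / 4 ≤ ρ.re)
    (_h1 : ρ.re < 1) (_hx : |ρ.im| ≤ x) (hexc : ¬ rayExcRegion c K 𝔪 ρ) :
    ρ.re ≤ 1 - c / (a * Real.log Q + Real.log (|ρ.im| + 4)) := by
  obtain ⟨hQ12, -, hlogd0, hlogdQ, -, -, -⟩ := raySize_facts h𝔪 hK hQK
  have hpack_c : ∀ (ψ : AddChar (Additive G) ℂ) (ρ : ℂ),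
      (((ψ = 0 → dedekindZeta₁ K ρ = 0) ∧ (ψ ≠ 0 → datumL h𝔪 hray hsep ψ ρ = 0)) ∧
        1 - c / (Real.log (((discr K).natAbs : ℝ) * ((Ideal.absNorm 𝔪 : ℕ) : ℝ)) + Real.log (|ρ.im| + 4)) < ρ.re) →
      ρ.im = 0 ∧ ψ + ψ = 0 :=
    fun ψ ρ h ↦ hpack ψ ρ ⟨h.1, rayLpRegion_mono h𝔪 hcc₀ h.2⟩
  have h1 := re_le_of_not_rayExcRegion h𝔪 hray hsep hpack_c ψ h0 hexc
  have hlog4 : 0 < Real.log (|ρ.im| + 4) := Real.log_pos (by linarith [abs_nonneg ρ.im])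
  have hlogQ : 0 ≤ Real.log Q := Real.log_nonneg (by linarith)
  have haQ : Real.log (((discr K).natAbs : ℝ) * ((Ideal.absNorm 𝔪 : ℕ) : ℝ)) ≤ a * Real.log Q := by nlinarith
  have : c / (a * Real.log Q + Real.log (|ρ.im| + 4)) ≤
      c / (Real.log (((discr K).natAbs : ℝ) * ((Ideal.absNorm 𝔪 : ℕ) : ℝ)) + Real.log (|ρ.im| + 4)) :=
    div_le_div_of_nonneg_left hc.le (by linarith) (by linarith)
  linarith

/-! ### The Deuring–Heilbronn repulsion as a zero-free region in `Q`-form -/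

/-- **Deuring–Heilbronn ⇒ zero-free region in `Q`-form** (see the module docstring).
[cite: LagariasMontgomeryOdlyzko1979, Theorem 5.1] [cite: ThornerZaman2017, Theorem 3.1] -/
theorem ray_zfr_of_zeroRepulsion {n : ℕ} (hn : 1 < n) (hKn : Module.finrank ℚ K = n) {C : ℝ} (hC : 0 < C)
    {β₁ c a x Q : ℝ} (ha : 1 ≤ a) (hQK : rayCondQ K 𝔪 ≤ Q)
    (hexc₁ : rayExcRegion c K 𝔪 (β₁ : ℂ)) (hβ1 : β₁ < 1) (hxQ : Q ≤ x) (hL4 : 4 ≤ Real.log x)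
    (hrep : ∀ (ψ : AddChar (Additive G) ℂ) (ρ : ℂ), rayFamF h𝔪 hray hsep ψ ρ = 0 → 1 / 2 ≤ ρ.re →
      ρ ≠ 1 → ρ ≠ β₁ →
        Real.log (1 / (C * (Real.log (((discr K).natAbs : ℝ) * ((Ideal.absNorm 𝔪 : ℕ) : ℝ)) +
            Module.finrank ℚ K * (Real.log (|ρ.im| + 2) + 1)) * (1 - β₁))) /
          (C * (Real.log (((discr K).natAbs : ℝ) * ((Ideal.absNorm 𝔪 : ℕ) : ℝ)) +
            Module.finrank ℚ K * (Real.log (|ρ.im| + 2) + 1))) ≤ 1 - ρ.re)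
    (hsmall : 2 * C * n * ((1 - β₁) * Real.log x) ≤ 1 / 3) :
    ∀ (ψ : AddChar (Additive G) ℂ) (ρ : ℂ), rayFamF h𝔪 hray hsep ψ ρ = 0 → 1 / 4 ≤ ρ.re →
      ρ.re < 1 → |ρ.im| ≤ x → ¬ rayExcRegion c K 𝔪 ρ →
        ρ.re ≤ 1 - min (Real.log (1 / (2 * C * n * ((1 - β₁) * Real.log x))) / (C * n))
          (a * Real.log Q / 2) / (a * Real.log Q + Real.log (|ρ.im| + 4)) := by
  intro ψ ρ h0 _ hre1 hγ hexc
  have hK : 1 < Module.finrank ℚ K := by rw [hKn]; exact hn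
  obtain ⟨hQ12, hdQ, hlogd0, hlogdQ, -, -, -⟩ := raySize_facts h𝔪 hK hQK
  have hlog12 : (2 : ℝ) ≤ Real.log 12 := by
    rw [Real.le_log_iff_exp_le (by norm_num)]
    have := Real.exp_one_lt_d9
    have h : Real.exp 2 = Real.exp 1 * Real.exp 1 := by rw [← Real.exp_add]; norm_num
    rw [h]; nlinarith [Real.exp_pos (1:ℝ)]
  have hlogQ : 2 ≤ Real.log Q := hlog12.trans (Real.log_le_log (by norm_num) hQ12)
  have hn2 : (2 : ℝ) ≤ n := by exact_mod_cast hn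
  have hx12 : (12 : ℝ) ≤ x := hQ12.trans hxQ
  have hx0 : 0 < x := by linarith
  set L : ℝ := Real.log x with hL
  set δ₁ : ℝ := 1 - β₁ with hδ₁
  have hδ₁0 : 0 < δ₁ := by rw [hδ₁]; linarith
  have hlog4 : 0 < Real.log (|ρ.im| + 4) := Real.log_pos (by linarith [abs_nonneg ρ.im])
  set Dn : ℝ := a * Real.log Q + Real.log (|ρ.im| + 4) with hDn
  have hDn0 : 0 < Dn := by rw [hDn]; nlinarith
  set cZ : ℝ := min (Real.log (1 / (2 * C * n * (δ₁ * L))) / (C * n)) (a * Real.log Q / 2) with hcZ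
  rcases lt_or_ge ρ.re (1 / 2) with hlt | hge
  · -- `Re ρ < 1/2`: `c_Z ≤ a log Q / 2 ≤ Dn / 2`
    have h1 : cZ / Dn ≤ 1 / 2 := by
      rw [div_le_iff₀ hDn0]
      have : cZ ≤ a * Real.log Q / 2 := min_le_right _ _
      rw [hDn]; nlinarith
    linarith
  · -- `Re ρ ≥ 1/2`: the repulsion
    have hρ1 : ρ ≠ 1 := by
      intro h; rw [h, Complex.one_re] at hre1; exact lt_irrefl _ hre1
    have hρβ : ρ ≠ (β₁ : ℂ) := by
      intro h; rw [h] at hexc; exact hexc hexc₁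
    have key := hrep ψ ρ h0 hge hρ1 hρβ
    rw [hKn] at key
    set d : ℝ := ((discr K).natAbs : ℝ) * ((Ideal.absNorm 𝔪 : ℕ) : ℝ) with hd
    have hlogQL : Real.log Q ≤ L := Real.log_le_log (by linarith) hxQ
    have hlog2 : 0 < Real.log (|ρ.im| + 2) := Real.log_pos (by linarith [abs_nonneg ρ.im])
    set ℒ : ℝ := Real.log d + n * (Real.log (|ρ.im| + 2) + 1) with hℒ
    have hℒ0 : 0 < ℒ := by rw [hℒ]; positivity
    -- `ℒ ≤ 2 n L`
    have hlogx2 : Real.log (|ρ.im| + 2) ≤ L + 1 := by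
      have h1 : Real.log (|ρ.im| + 2) ≤ Real.log (x + 2) :=
        Real.log_le_log (by linarith [abs_nonneg ρ.im]) (by linarith)
      have h2 : x + 2 ≤ Real.exp 1 * x := by
        have := Real.exp_one_gt_d9; nlinarith
      have h3 : Real.log (x + 2) ≤ Real.log (Real.exp 1 * x) := Real.log_le_log (by linarith) h2
      rw [Real.log_mul (Real.exp_pos 1).ne' hx0.ne', Real.log_exp] at h3
      linarith
    have hℒL : ℒ ≤ 2 * n * L := by
      rw [hℒ]
      have h1 : (n : ℝ) * (Real.log (|ρ.im| + 2) + 1) ≤ n * (L + 2) := by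
        refine mul_le_mul_of_nonneg_left ?_ (by linarith); linarith
      have h2 : ((n : ℝ) - 1) * 4 ≤ ((n : ℝ) - 1) * L := mul_le_mul_of_nonneg_left hL4 (by linarith)
      have h3 : Real.log d ≤ L := hlogdQ.trans hlogQL
      have e : (n : ℝ) * (L + 2) = n * L + 2 * n := by ring
      have e2 : 2 * (n : ℝ) * L = n * L + (((n : ℝ) - 1) * L + L) := by ring
      linarith
    -- `ℒ ≤ n Dn`
    have hℒD : ℒ ≤ n * Dn := by
      rw [hℒ, hDn]
      have h1 : Real.log (|ρ.im| + 2) ≤ Real.log (|ρ.im| + 4) :=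
        Real.log_le_log (by linarith [abs_nonneg ρ.im]) (by linarith)
      have h2 : Real.log d + n ≤ n * (a * Real.log Q) := by
        have h21 : Real.log Q ≤ a * Real.log Q := by nlinarith
        have h22 : (n : ℝ) * Real.log Q ≤ n * (a * Real.log Q) :=
          mul_le_mul_of_nonneg_left h21 (by linarith)
        have h23 : ((n : ℝ) - 1) * 2 ≤ ((n : ℝ) - 1) * Real.log Q :=
          mul_le_mul_of_nonneg_left hlogQ (by linarith)
        have h24 : (n : ℝ) * Real.log Q = Real.log Q + ((n : ℝ) - 1) * Real.log Q := by ring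
        linarith
      have h3 : (n : ℝ) * Real.log (|ρ.im| + 2) ≤ n * Real.log (|ρ.im| + 4) :=
        mul_le_mul_of_nonneg_left h1 (by linarith)
      have e : Real.log d + n * (Real.log (|ρ.im| + 2) + 1) =
          (Real.log d + n) + n * Real.log (|ρ.im| + 2) := by ring
      have e' : (n : ℝ) * (a * Real.log Q + Real.log (|ρ.im| + 4)) =
          n * (a * Real.log Q) + n * Real.log (|ρ.im| + 4) := by ring
      rw [e, e']
      linarith
    -- `t = C ℒ δ₁ ≤ 2 C n δ₁ L ≤ 1/3`
    set t : ℝ := C * ℒ * δ₁ with ht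
    have ht0 : 0 < t := by positivity
    have htle : t ≤ 2 * C * n * (δ₁ * L) := by
      rw [ht]
      have h1 : C * ℒ ≤ C * (2 * n * L) := mul_le_mul_of_nonneg_left hℒL hC.le
      have h2 : C * ℒ * δ₁ ≤ C * (2 * n * L) * δ₁ := mul_le_mul_of_nonneg_right h1 hδ₁0.le
      linarith
    have ht1 : t ≤ 1 / 3 := htle.trans hsmall
    have hsm0 : 0 < 2 * C * n * (δ₁ * L) := lt_of_lt_of_le ht0 htle
    set ℓ : ℝ := Real.log (1 / (2 * C * n * (δ₁ * L))) with hℓ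
    have hℓle : ℓ ≤ Real.log (1 / t) := by
      rw [hℓ]; exact Real.log_le_log (by positivity) (one_div_le_one_div_of_le ht0 htle)
    have hℓ0 : 0 ≤ ℓ := by
      rw [hℓ]; refine Real.log_nonneg ?_
      rw [le_div_iff₀ hsm0]; linarith
    have hlogt0 : 0 ≤ Real.log (1 / t) := hℓ0.trans hℓle
    have hkey' : Real.log (1 / t) / (C * ℒ) ≤ 1 - ρ.re := key
    have h1 : cZ / Dn ≤ ℓ / (C * n) / Dn :=
      div_le_div_of_nonneg_right (min_le_left _ _) hDn0.le
    have h2 : ℓ / (C * n) / Dn = ℓ / (C * (n * Dn)) := by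
      rw [div_div]; ring_nf
    have h3 : ℓ / (C * (n * Dn)) ≤ Real.log (1 / t) / (C * (n * Dn)) :=
      div_le_div_of_nonneg_right hℓle (by positivity)
    have h4 : Real.log (1 / t) / (C * (n * Dn)) ≤ Real.log (1 / t) / (C * ℒ) :=
      div_le_div_of_nonneg_left hlogt0 (by positivity) (mul_le_mul_of_nonneg_left hℒD hC.le)
    have : cZ / Dn ≤ 1 - ρ.re := by
      calc cZ / Dn ≤ ℓ / (C * n) / Dn := h1
        _ = ℓ / (C * (n * Dn)) := h2
        _ ≤ Real.log (1 / t) / (C * (n * Dn)) := h3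
        _ ≤ Real.log (1 / t) / (C * ℒ) := h4
        _ ≤ 1 - ρ.re := hkey'
    linarith

/-! ### The trivial-zero and left-line terms of the members `ψ ≠ 0` -/

/-- **The trivial-zero term of `L_ψ`** (`ψ ≠ 0`): `m_ψ(0)(L + ε) ≤ 1152 e^{L/4}` for `Q_𝔪 ≤ Q ≤ e^{L/8}`,
`0 ≤ ε ≤ 1 ≤ L` (`m_ψ(0) ≤ 8(log(|d_K|N𝔣) + 6n) ≤ 56 Q`, `L ≤ 8 e^{L/8}`). [cite: ThornerZaman2019, Lemma 2.5] -/
theorem rayFamMult_zero_term_le (hK : 1 < Module.finrank ℚ K) {ψ : AddChar (Additive G) ℂ} (hψ : ψ ≠ 0)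
    {Q L ε : ℝ} (hQK : rayCondQ K 𝔪 ≤ Q) (hL : 1 ≤ L) (hε0 : 0 ≤ ε) (hε1 : ε ≤ 1)
    (hQexp : Q ≤ Real.exp (L / 8)) :
    (analyticOrderNatAt (rayFamF h𝔪 hray hsep ψ) 0 : ℝ) * (L + ε) ≤ 1152 * Real.exp (L / 4) := by
  obtain ⟨hQ12, hdQ, hlogd0, hlogdQ, hlogQ1, hnQ, -⟩ := raySize_facts h𝔪 hK hQK
  set D := datumData h𝔪 hray hsep ψ hψ with hD
  rw [rayFamF_of_ne h𝔪 hray hsep hψ]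
  have hnt := charFun_nontrivial hsep hψ
  have hm₀ := analyticOrderNatAt_continuation_zero_le D.isRayClassCharacter D.isPrimitive D.isSignType D.ne_bot
    (D.nontrivial hnt) D.differentiable D.L_eq
  -- `log(|d_K| N𝔣) ≤ log(|d_K| N𝔪) ≤ Q - 1`
  have hdisc : |(discr K : ℝ)| = ((discr K).natAbs : ℝ) := by rw [Nat.cast_natAbs, Int.cast_abs]
  have hd1 : (1 : ℝ) ≤ ((discr K).natAbs : ℝ) := by exact_mod_cast Int.natAbs_pos.mpr (discr_ne_zero K)
  have hf1 : (1 : ℝ) ≤ ((Ideal.absNorm D.𝔣 : ℕ) : ℝ) := one_le_absNorm_cast D.ne_bot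
  have hcond : Real.log (|(discr K : ℝ)| * (Ideal.absNorm D.𝔣 : ℝ)) ≤
      Real.log (((discr K).natAbs : ℝ) * ((Ideal.absNorm 𝔪 : ℕ) : ℝ)) := by
    rw [hdisc]
    exact Real.log_le_log (by nlinarith) (mul_le_mul_of_nonneg_left D.absNorm_le (by linarith))
  have h1 : 8 * (Real.log (|(discr K : ℝ)| * (Ideal.absNorm D.𝔣 : ℝ)) + 6 * Module.finrank ℚ K) ≤ 72 * Q := by
    linarith
  have h2 : L + ε ≤ 2 * L := by linarith
  have h3 : (analyticOrderNatAt D.L 0 : ℝ) * (L + ε) ≤ 72 * Q * (2 * L) :=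
    mul_le_mul (hm₀.trans h1) h2 (by linarith) (by positivity)
  have hL8 := le_eight_mul_exp_div L
  have hee : Real.exp (L / 8) * Real.exp (L / 8) = Real.exp (L / 4) := by
    rw [← Real.exp_add]; ring_nf
  have h4 : Q * L ≤ Real.exp (L / 8) * (8 * Real.exp (L / 8)) :=
    mul_le_mul hQexp hL8 (by linarith) (Real.exp_pos _).le
  nlinarith [Real.exp_pos (L / 8)]

/-- **The left-line integral of `L_ψ`** (`ψ ≠ 0`): with the absolute constant `C` of
`exists_norm_logDeriv_continuation_left_le` and the smooth-transition bound `M`,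
`‖J_ψ(0)‖ ≤ 8 · leftLineConst · C (n + 1) M` for `g = tzTest L ε`, `ε = e^{−νL}`, `0 < ν ≤ 1/64`,
`Q_𝔪 ≤ Q ≤ e^{L/8}`, `0 < ε < L/2`, `ε ≤ 1`. [cite: ThornerZaman2019, Lemma 4.3] -/
theorem rayLeftLine_term_le (hK : 1 < Module.finrank ℚ K) {C : ℝ} (hC0 : 0 < C)
    (hC : ∀ (K : Type) [Field K] [NumberField K] (𝔪 : Ideal (𝓞 K))
      (ψ : HeightOneSpectrum (𝓞 K) → ℂ) (p : Finset {w : InfinitePlace K // w.IsReal}),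
      IsRayClassCharacter 𝔪 ψ → IsPrimitive 𝔪 ψ → IsSignType 𝔪 ψ p → 𝔪 ≠ ⊥ →
      ∀ (L L' : ℂ → ℂ), Differentiable ℂ L → (∀ s : ℂ, 1 < s.re → L s = rayClassLSeries 𝔪 ψ s) →
        Differentiable ℂ L' → (∀ s : ℂ, 1 < s.re → L' s = rayClassLSeries 𝔪 (star ψ) s) →
      ∀ t : ℝ, ‖logDeriv L (-1 / 2 + t * Complex.I)‖ ≤
        C * (Module.finrank ℚ K + 1) * (Real.log (|(discr K : ℝ)| * (Ideal.absNorm 𝔪 : ℝ)) + Real.log (|t| + 4)))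
    {M : ℝ} (hM : ∀ y : ℝ, |iteratedDeriv 1 Real.smoothTransition y| ≤ M ∧
      |iteratedDeriv 2 Real.smoothTransition y| ≤ M)
    {ψ : AddChar (Additive G) ℂ} (hψ : ψ ≠ 0) {Q L ε ν : ℝ} (hQK : rayCondQ K 𝔪 ≤ Q) (hL : 0 < L) (hε : 0 < ε)
    (hεL : ε < L / 2) (hε1 : ε ≤ 1) (hν64 : ν ≤ 1 / 64) (hεexp : ε = Real.exp (-(ν * L)))
    (hQexp : Q ≤ Real.exp (L / 8)) :
    ‖rcEFRemainder (datumData h𝔪 hray hsep ψ hψ).L (tzTest L ε) 0‖ ≤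
      8 * leftLineConst * C * (Module.finrank ℚ K + 1) * M := by
  obtain ⟨hQ12, hdQ, hlogd0, hlogdQ, hlogQ1, hnQ, -⟩ := raySize_facts h𝔪 hK hQK
  set D := datumData h𝔪 hray hsep ψ hψ with hD
  have hnt := charFun_nontrivial hsep hψ
  have hJ := norm_rcEFRemainder_tzTest_zero_le hC0 hC D.isRayClassCharacter D.isPrimitive D.isSignType D.ne_bot
    (D.nontrivial hnt) D.differentiable D.L_eq D.differentiable_Lconj (fun s hs ↦ D.Lconj_eq hs) hM hL hε hεL
  have hM0 : 0 ≤ M := le_trans (abs_nonneg _) (hM 0).1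
  have hlC := leftLineConst_nonneg
  -- `log(|d_K| N𝔣) + log 4 + 1 ≤ 2 Q`
  have hdisc : |(discr K : ℝ)| = ((discr K).natAbs : ℝ) := by rw [Nat.cast_natAbs, Int.cast_abs]
  have hd1 : (1 : ℝ) ≤ ((discr K).natAbs : ℝ) := by exact_mod_cast Int.natAbs_pos.mpr (discr_ne_zero K)
  have hf1 : (1 : ℝ) ≤ ((Ideal.absNorm D.𝔣 : ℕ) : ℝ) := one_le_absNorm_cast D.ne_bot
  have hcond : Real.log (|(discr K : ℝ)| * (Ideal.absNorm D.𝔣 : ℝ)) ≤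
      Real.log (((discr K).natAbs : ℝ) * ((Ideal.absNorm 𝔪 : ℕ) : ℝ)) := by
    rw [hdisc]
    exact Real.log_le_log (by nlinarith) (mul_le_mul_of_nonneg_left D.absNorm_le (by linarith))
  have hlogA0 : 0 ≤ Real.log (|(discr K : ℝ)| * (Ideal.absNorm D.𝔣 : ℝ)) := by
    rw [hdisc]; exact Real.log_nonneg (by nlinarith)
  have hlogd4 : Real.log (|(discr K : ℝ)| * (Ideal.absNorm D.𝔣 : ℝ)) + Real.log 4 + 1 ≤ 2 * Q := by
    have hlog4 : Real.log 4 ≤ 2 := by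
      have : Real.log 4 = 2 * Real.log 2 := by
        rw [show (4:ℝ) = 2 ^ 2 by norm_num, Real.log_pow]; norm_num
      rw [this]; have := Real.log_two_lt_d9; linarith
    linarith
  have hexp1 : Real.exp (-(L / 4) + ε / 2) ≤ 2 * Real.exp (-(L / 4)) := by
    rw [Real.exp_add, mul_comm]
    refine mul_le_mul_of_nonneg_right ?_ (Real.exp_pos _).le
    have hsq : Real.exp (ε / 2) ^ 2 < 2 ^ 2 := by
      rw [← Real.exp_nat_mul]
      have h1 : Real.exp ((2 : ℕ) * (ε / 2)) ≤ Real.exp 1 := Real.exp_le_exp.2 (by push_cast; linarith)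
      have := Real.exp_one_lt_d9; linarith
    exact (lt_of_pow_lt_pow_left₀ 2 (by norm_num) hsq).le
  have hexp2 : 2 * M / ε ≤ 2 * M * Real.exp (L / 64) := by
    rw [hεexp, div_eq_mul_inv, ← Real.exp_neg, neg_neg]
    refine mul_le_mul_of_nonneg_left (Real.exp_le_exp.2 ?_) (by positivity)
    nlinarith
  have hlog40 : 0 ≤ Real.log 4 := Real.log_nonneg (by norm_num)
  have hprod : (Real.log (|(discr K : ℝ)| * (Ideal.absNorm D.𝔣 : ℝ)) + Real.log 4 + 1) *
      (Real.exp (-(L / 4) + ε / 2) * (2 * M / ε)) ≤ 8 * M := by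
    calc (Real.log (|(discr K : ℝ)| * (Ideal.absNorm D.𝔣 : ℝ)) + Real.log 4 + 1) *
          (Real.exp (-(L / 4) + ε / 2) * (2 * M / ε))
        ≤ (2 * Q) * ((2 * Real.exp (-(L / 4))) * (2 * M * Real.exp (L / 64))) :=
          mul_le_mul hlogd4 (mul_le_mul hexp1 hexp2 (by positivity) (by positivity))
            (by positivity) (by positivity)
      _ ≤ (2 * Real.exp (L / 8)) * ((2 * Real.exp (-(L / 4))) * (2 * M * Real.exp (L / 64))) :=
          mul_le_mul_of_nonneg_right (by linarith) (by positivity)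
      _ = 8 * M * Real.exp (L / 8 + -(L / 4) + L / 64) := by
          rw [Real.exp_add, Real.exp_add]; ring
      _ ≤ 8 * M * 1 := by
          refine mul_le_mul_of_nonneg_left ?_ (by positivity)
          rw [Real.exp_le_one_iff]; nlinarith
      _ = 8 * M := mul_one _
  refine hJ.trans ?_
  rw [mul_assoc (leftLineConst * (C * ((Module.finrank ℚ K : ℝ) + 1)))]
  calc leftLineConst * (C * ((Module.finrank ℚ K : ℝ) + 1)) *
        ((Real.log (|(discr K : ℝ)| * (Ideal.absNorm D.𝔣 : ℝ)) + Real.log 4 + 1) *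
          (Real.exp (-(L / 4) + ε / 2) * (2 * M / ε)))
      ≤ leftLineConst * (C * ((Module.finrank ℚ K : ℝ) + 1)) * (8 * M) :=
        mul_le_mul_of_nonneg_left hprod (by positivity)
    _ = _ := by ring

end Summit.QuantumAdvantage.QuantumAdvantage.Theorems.DegreeOnePrimesEscape

end
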